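import Summits.NavierStokesRegularity.FluidComputer.PalasekTowerBurgersLayerSheetUniform

/-!
# The LOW-STRAIN sheet read-out: a Burgers layer in the strain `(18/25)·N_j²` (`≈ 0.41·A₀` at the base)
# reads out every level of the rigid register

Cell `ns-blowup`, seat `ns-blowup-ecbridge-4` (g6; D-0074 GROUP C «BRIDGE SUPPORT», stub `first_episode` of the crux
`EpisodeBase` = item stmt-NavierStokesRegularity-19179 of the route `PalasekTowerBreakdown`, line `slot`; bears also on
the read-out halves of 19249 / 19250 / 19178; supports / evidence only, nothing claimed). `PalasekTowerBurgersLayerSheetUniform`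
(p480714) reads every level `j` as the Burgers vortex LAYER `burgersLayer ((6/5)N_j²) 1 ((12/5)Y_j)` of the crux idea
«orthogonal-seed-contact-strain» (19179 evidence #47/#48) — strain `(6/5)N_j²`, i.e. `2.6·10⁵ ≈ 0.75·A₀` at `j = 1`, the
number the card's host must manufacture (its item (4); lens-profile g2's re-tune, evidence #56, measures the demand against
the kinematic contact strain). HOW LITTLE STRAIN DOES A LAYER READ-OUT NEED? The gradient floor is met by the shear slope
`V′(0) = ΔU (γ/2π)^{1/2}` and the two-sided ceiling caps the jump, `ΔU/2 ≤ (5/3)Y_j`; so `γ ≳ 2π (3N_j/10)² ≈ 0.57 N_j²` is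
forced inside the layer family, and this file certifies the admissible corner just above it: the layer
`u_j^low := burgersLayer ((18/25)N_j²) 1 (3Y_j)` (rate `κ_j = (3/5)N_j` exactly, jump `3Y_j`) meets, for EVERY
`R : TowerRates` and EVERY level `j` (namespace `SheetReadoutLow`):

* velocity floor `Y_j ≤ ‖u_j^low(x⋆)‖` at `x⋆ = (5/(3N_j), 0, 0)` (`κ x⋆₀ = 1`, `V ≥ 2Y_j/√π ≥ 1.12 Y_j` from
  `∫₀¹ e^{−t²} ≥ 2/3`), `‖x⋆‖ ≤ 2/N_j`;
* strain floor `A_j ≤ ‖Du_j^low(0)‖` (`V′(0) = (9/5)A_j/√π ≥ 1.014 A_j`);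
* ceiling `(5/3)Y_j` on the slab `N_j⁴(x₀² + x₂²) ≤ Y_j²` (`(324/625 + 9/4)Y² = 2.7684 Y² ≤ (25/9)Y²`);
* core ledger `N_j^{β−2} ≤ circulation` on the radius-`1/N_j` circle (`≥ (66/125)·3·√π·(22/25)… ≥ 2.6 N_j^{β−2}`:
  `circulation_circle_ge` with `κρ = 3/5`),

the register's clauses (floor for ball radius `≥ 2/N_j`, strain, slab ceiling, `CoreLedger` `j`-clause) and
`SheetReadoutLow.uniform j` on the wide rates; and the BASE NUMBER: `0.41·A₀ < (18/25)N₁² < 0.42·A₀` on `TowerRates.wide`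
(`strain_low_one_bounds`; the card's layer needs `(6/5)N₁² ≈ 0.69·A₀`, the round Burgers child `≥ 0.5·A₀` by
`PalasekTowerBurgersNumberLevelZero*`).

LABEL: MODEL-side register arithmetic on exact, steady, infinite-energy profiles. WHAT THIS IS NOT: not Navier–Stokes
evidence — nothing about any registered stage, any host, `HeredityAt j`, `RungG j`, `EpisodeBaseG` or blow-up; a
read-out profile meeting the faces says nothing about whether a flow reaches it; the register's ceiling is global in `x`
and is met only on the slab where the layer is the local model. References: J. M. Burgers, Adv. Appl. Mech. 1 (1948)
171–199; S. Palasek, arXiv:2605.13827 §3–§4 [cite: Palasek2026ElementaryModel, §4]. [folklore] calculus.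
-/

noncomputable section

namespace Summit.NavierStokesRegularity.FluidComputer.PalasekTowerClayBridge

open Set MeasureTheory Filter Topology Function Real intervalIntegral
open scoped ContDiff
open Literature.Analysis.FluidPDE

namespace SheetReadoutLow

variable (R : TowerRates) (j : ℕ)

/-! ## §1 The low-strain sheet layer of a level: rate and slope -/

/-- The rate of the low-strain layer is exactly `κ_j = (3/5) N_j` (`((18/25)N²/2)^{1/2} = (9/25)^{1/2} N`). [folklore] -/
theorem rate_eq : burgersLayerRate (18 / 25 * R.N j ^ 2) 1 = 3 / 5 * R.N j := by
  have hN : 0 ≤ R.N j := (R.N_pos j).le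
  unfold burgersLayerRate
  rw [show (18 : ℝ) / 25 * R.N j ^ 2 / (2 * 1) = (3 / 5 * R.N j) ^ 2 by ring, Real.sqrt_sq (by positivity)]

/-- The rate is positive. [folklore] -/
theorem rate_pos : 0 < burgersLayerRate (18 / 25 * R.N j ^ 2) 1 := by
  rw [rate_eq]; exact mul_pos (by norm_num) (R.N_pos j)

/-! ## §2 The four faces, uniformly in `R` and `j` -/

/-- **Strain floor**: `A_j ≤ ‖Du_j^low(0)‖` (`V′(0) = 3Y_j·(3/5)N_j/√π = (9/5)A_j/√π ≥ A_j` as `√π ≤ 1.775`).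
[folklore] -/
theorem strainFloor :
    R.A j ≤ ‖fderiv ℝ (burgersLayer (18 / 25 * R.N j ^ 2) 1 (3 * R.Y j)) 0‖ := by
  have hN0 : 0 < R.N j := R.N_pos j
  have hY0 : 0 < R.Y j := Real.rpow_pos_of_pos hN0 _
  have h := slope_le_norm_fderiv_burgersLayer (γ := 18 / 25 * R.N j ^ 2) (ν := 1) (ΔU := 3 * R.Y j)
    (x := (0 : EuclideanSpace ℝ (Fin 3))) rfl
  rw [rate_eq] at h
  refine le_trans ?_ h
  have hπs : 0 < Real.sqrt Real.pi := Real.sqrt_pos.2 Real.pi_pos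
  rw [← OrthogonalSeed.Y_mul_N R j, show (3 : ℝ) * R.Y j / Real.sqrt Real.pi * (3 / 5 * R.N j) =
      (9 / 5 / Real.sqrt Real.pi) * (R.Y j * R.N j) by ring]
  have hc : (1 : ℝ) ≤ 9 / 5 / Real.sqrt Real.pi := by
    rw [le_div_iff₀ hπs, one_mul]; linarith [OrthogonalSeed.sqrt_pi_le]
  have hYN : 0 ≤ R.Y j * R.N j := by positivity
  nlinarith

/-- **Velocity floor**: at `x⋆ = (1/κ_j, 0, 0) = (5/(3N_j), 0, 0)` the shear alone is `V(1/κ_j) ≥ 2Y_j/√π > Y_j`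
(`∫₀¹ e^{−t²} ≥ 2/3`). [folklore] -/
theorem speedFloor :
    R.Y j ≤ ‖burgersLayer (18 / 25 * R.N j ^ 2) 1 (3 * R.Y j)
      !₂[1 / burgersLayerRate (18 / 25 * R.N j ^ 2) 1, 0, 0]‖ := by
  set κ := burgersLayerRate (18 / 25 * R.N j ^ 2) 1 with hκ
  have hκ0 : 0 < κ := rate_pos R j
  have hY0 : 0 ≤ R.Y j := (Real.rpow_pos_of_pos (R.N_pos j) _).le
  set x : EuclideanSpace ℝ (Fin 3) := !₂[1 / κ, 0, 0] with hx
  have hx0 : x 0 = 1 / κ := by simp [hx]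
  have hV : (3 * R.Y j) / Real.sqrt Real.pi * (2 / 3) ≤
      burgersLayerProfile (18 / 25 * R.N j ^ 2) 1 (3 * R.Y j) (x 0) := by
    refine burgersLayerProfile_ge_of_one_le (by positivity) ?_
    rw [hx0, ← hκ, mul_one_div_cancel hκ0.ne']
  have hπs : 0 < Real.sqrt Real.pi := Real.sqrt_pos.2 Real.pi_pos
  have hc1 : (1 : ℝ) ≤ 2 / Real.sqrt Real.pi := by
    rw [le_div_iff₀ hπs]; linarith [OrthogonalSeed.sqrt_pi_le_two]
  have hc : R.Y j ≤ (3 * R.Y j) / Real.sqrt Real.pi * (2 / 3) := by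
    have := mul_le_mul_of_nonneg_left hc1 hY0
    calc R.Y j = R.Y j * 1 := (mul_one _).symm
      _ ≤ R.Y j * (2 / Real.sqrt Real.pi) := this
      _ = (3 * R.Y j) / Real.sqrt Real.pi * (2 / 3) := by ring
  calc R.Y j ≤ burgersLayerProfile (18 / 25 * R.N j ^ 2) 1 (3 * R.Y j) (x 0) := hc.trans hV
    _ = burgersLayer (18 / 25 * R.N j ^ 2) 1 (3 * R.Y j) x 1 := (burgersLayer_apply_one _ _ _ x).symm
    _ ≤ |burgersLayer (18 / 25 * R.N j ^ 2) 1 (3 * R.Y j) x 1| := le_abs_self _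
    _ = ‖burgersLayer (18 / 25 * R.N j ^ 2) 1 (3 * R.Y j) x 1‖ := (Real.norm_eq_abs _).symm
    _ ≤ ‖burgersLayer (18 / 25 * R.N j ^ 2) 1 (3 * R.Y j) x‖ := PiLp.norm_apply_le _ _

/-- The read-out point lies within `2/N_j` of the origin (`1/κ_j = 5/(3N_j)`). [folklore] -/
theorem norm_point_le :
    ‖(!₂[1 / burgersLayerRate (18 / 25 * R.N j ^ 2) 1, 0, 0] : EuclideanSpace ℝ (Fin 3))‖ ≤ 2 / R.N j := by
  have hN : 0 < R.N j := R.N_pos j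
  have hκ0 := rate_pos R j
  have hval : ‖(!₂[1 / burgersLayerRate (18 / 25 * R.N j ^ 2) 1, 0, 0] : EuclideanSpace ℝ (Fin 3))‖ =
      1 / burgersLayerRate (18 / 25 * R.N j ^ 2) 1 := by
    have hsq := norm_vec3_sq (1 / burgersLayerRate (18 / 25 * R.N j ^ 2) 1) 0 0
    exact (sq_eq_sq₀ (norm_nonneg _) (by positivity)).1 (by rw [hsq]; ring)
  rw [hval, rate_eq, div_le_div_iff₀ (by positivity) hN]
  nlinarith

/-- **Slab ceiling**: `‖u_j^low(x)‖ ≤ (5/3)Y_j` on the slab `N_j⁴(x₀² + x₂²) ≤ Y_j²`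
(`(18/25)²·1 + (3/2)² = 2.7684 ≤ 25/9`). [folklore] -/
theorem slabCeiling (x : EuclideanSpace ℝ (Fin 3)) (hx : R.N j ^ 4 * (x 0 ^ 2 + x 2 ^ 2) ≤ R.Y j ^ 2) :
    ‖burgersLayer (18 / 25 * R.N j ^ 2) 1 (3 * R.Y j) x‖ ≤ 5 / 3 * R.Y j := by
  have hN : 0 < R.N j := R.N_pos j
  have hY0 : 0 ≤ R.Y j := (Real.rpow_pos_of_pos hN _).le
  have hV := burgersLayerProfile_sq_le (γ := 18 / 25 * R.N j ^ 2) (ν := 1) (ΔU := 3 * R.Y j)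
    (by positivity) one_pos (by positivity) (x 0)
  have hsq := norm_burgersLayer_sq (18 / 25 * R.N j ^ 2) 1 (3 * R.Y j) x
  have h1 : ‖burgersLayer (18 / 25 * R.N j ^ 2) 1 (3 * R.Y j) x‖ ^ 2 ≤ (5 / 3 * R.Y j) ^ 2 := by
    rw [hsq]
    nlinarith [hx, hV]
  nlinarith [norm_nonneg (burgersLayer (18 / 25 * R.N j ^ 2) 1 (3 * R.Y j) x), h1, hY0]

/-- **Core-ledger floor**: on the horizontal circle of radius `1/N_j` the low-strain layer carries circulation
`≥ 3·(3/5)·(22/25)·√π · N_j^{β−2} ≥ 2.6·N_j^{β−2}` (`circulation_circle_ge` with `κρ = 3/5`). [folklore] -/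
theorem coreFloor :
    R.N j ^ (R.β - 2) ≤ circulation (burgersLayer (18 / 25 * R.N j ^ 2) 1 (3 * R.Y j))
      (fun s : ℝ => (!₂[(1 / R.N j) * Real.cos (2 * π * s), (1 / R.N j) * Real.sin (2 * π * s), 0] :
        EuclideanSpace ℝ (Fin 3))) := by
  have hN : 0 < R.N j := R.N_pos j
  have hY0 : 0 ≤ R.Y j := (Real.rpow_pos_of_pos hN _).le
  have h := circulation_circle_ge (γ := 18 / 25 * R.N j ^ 2) (ν := 1) (ΔU := 3 * R.Y j)
    (by positivity) one_pos (by positivity) (1 / R.N j)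
  refine le_trans ?_ h
  rw [rate_eq, ← SheetReadout.Y_div_N]
  have hkr : (3 / 5 * R.N j) ^ 2 * (1 / R.N j) ^ 2 = 9 / 25 := by field_simp; ring
  rw [hkr]
  have hπs : 0 < Real.sqrt Real.pi := Real.sqrt_pos.2 Real.pi_pos
  have hsqπ : (1.7 : ℝ) ≤ Real.sqrt Real.pi := by
    rw [show (1.7 : ℝ) = Real.sqrt (1.7 ^ 2) by rw [Real.sqrt_sq (by norm_num)]]
    exact Real.sqrt_le_sqrt (by linarith [Real.pi_gt_three])
  have hππ : π / Real.sqrt Real.pi = Real.sqrt Real.pi := Real.div_sqrt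
  have hrw : π * (3 * R.Y j / Real.sqrt Real.pi * (3 / 5 * R.N j * (1 / R.N j) ^ 2 * (1 - 9 / 25 / 3))) =
      (3 * (3 / 5) * (22 / 25) * (π / Real.sqrt Real.pi)) * (R.Y j / R.N j) := by
    field_simp
    ring
  rw [hrw, hππ]
  have hc : (1 : ℝ) ≤ 3 * (3 / 5) * (22 / 25) * Real.sqrt Real.pi := by nlinarith
  have hYN : 0 ≤ R.Y j / R.N j := by positivity
  nlinarith

/-! ## §3 The register's clauses, every level (rigid schedules on the rates `R`) -/

variable {R}

/-- **Floor clause at level `j`** (`Stage.floor`, slice replaced by the low-strain layer; ball radius `≥ 2/N_j`).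
[folklore] -/
theorem floor_clause (S : Schedule R) (hS : S.Rigid) (hr : 2 / R.N j ≤ S.radius) :
    ∃ x : EuclideanSpace ℝ (Fin 3), ‖x‖ ≤ S.radius ∧
      S.c₁ * R.Y j ≤ ‖burgersLayer (18 / 25 * R.N j ^ 2) 1 (3 * R.Y j) x‖ :=
  ⟨_, (norm_point_le R j).trans hr, by rw [hS.c₁_eq, one_mul]; exact speedFloor R j⟩

/-- **Strain clause at level `j`** (`Margins.withStrain`, slice replaced by the low-strain layer). [folklore] -/
theorem strain_clause (S : Schedule R) (hS : S.Rigid) (hr : 0 ≤ S.radius) :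
    ∃ x : EuclideanSpace ℝ (Fin 3), ‖x‖ ≤ S.radius ∧
      S.c₁ * R.A j ≤ ‖fderiv ℝ (burgersLayer (18 / 25 * R.N j ^ 2) 1 (3 * R.Y j)) x‖ :=
  ⟨0, by rwa [norm_zero], by rw [hS.c₁_eq, one_mul]; exact strainFloor R j⟩

/-- **Ceiling clause at level `j` on the slab** (`Stage.ceiling`, slice replaced by the low-strain layer). [folklore] -/
theorem ceiling_clause (S : Schedule R) (hS : S.Rigid) (x : EuclideanSpace ℝ (Fin 3))
    (hx : R.N j ^ 4 * (x 0 ^ 2 + x 2 ^ 2) ≤ R.Y j ^ 2) :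
    ‖burgersLayer (18 / 25 * R.N j ^ 2) 1 (3 * R.Y j) x‖ ≤ S.c₂ * R.Y j := by
  rw [hS.c₂_eq]; exact slabCeiling R j x hx

/-- **Core-ledger clause at level `j`** (the `j`-clause of `CoreLedger R S k u`, slice replaced by the low-strain
layer): the circle of radius `1/N_j` about the origin is admissible and carries circulation `≥ c₁ N_j^{β−2}`. [folklore] -/
theorem coreLedger_clause (S : Schedule R) (hS : S.Rigid) (hr : 0 ≤ S.radius) :
    ∃ (x : EuclideanSpace ℝ (Fin 3)) (γ : ℝ → EuclideanSpace ℝ (Fin 3)),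
      ‖x‖ ≤ S.radius ∧ ContDiff ℝ 1 γ ∧ γ 0 = γ 1 ∧
      (∀ s ∈ Icc (0 : ℝ) 1, γ s ∈ Metric.closedBall x (1 / R.N j)) ∧
      (∀ s ∈ Icc (0 : ℝ) 1, ‖deriv γ s‖ ≤ 8 * π / R.N j) ∧
      S.c₁ * R.N j ^ (R.β - 2) ≤
        circulation (burgersLayer (18 / 25 * R.N j ^ 2) 1 (3 * R.Y j)) γ := by
  have hρ : 0 ≤ 1 / R.N j := (one_div_pos.2 (R.N_pos j)).le
  refine ⟨0, fun s : ℝ => (!₂[(1 / R.N j) * Real.cos (2 * π * s), (1 / R.N j) * Real.sin (2 * π * s), 0] :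
      EuclideanSpace ℝ (Fin 3)), by rwa [norm_zero], contDiff_circle _, circle_closed _,
    fun s _ => circle_mem_closedBall hρ s, fun s _ => ?_, by rw [hS.c₁_eq, one_mul]; exact coreFloor R j⟩
  have := norm_deriv_circle_le hρ s
  rw [show 8 * π * (1 / R.N j) = 8 * π / R.N j by ring] at this
  exact this

/-- **The low-strain sheet read-out is `j`-UNIFORM on the wide rates** (the four faces, every level `j`). [folklore] -/
theorem uniform (j : ℕ) :
    TowerRates.wide.Y j ≤ ‖burgersLayer (18 / 25 * TowerRates.wide.N j ^ 2) 1 (3 * TowerRates.wide.Y j)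
        !₂[1 / burgersLayerRate (18 / 25 * TowerRates.wide.N j ^ 2) 1, 0, 0]‖ ∧
    TowerRates.wide.A j ≤
      ‖fderiv ℝ (burgersLayer (18 / 25 * TowerRates.wide.N j ^ 2) 1 (3 * TowerRates.wide.Y j)) 0‖ ∧
    (∀ x : EuclideanSpace ℝ (Fin 3),
      TowerRates.wide.N j ^ 4 * (x 0 ^ 2 + x 2 ^ 2) ≤ TowerRates.wide.Y j ^ 2 →
        ‖burgersLayer (18 / 25 * TowerRates.wide.N j ^ 2) 1 (3 * TowerRates.wide.Y j) x‖ ≤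
          5 / 3 * TowerRates.wide.Y j) ∧
    TowerRates.wide.N j ^ (TowerRates.wide.β - 2) ≤
      circulation (burgersLayer (18 / 25 * TowerRates.wide.N j ^ 2) 1 (3 * TowerRates.wide.Y j))
        (fun s : ℝ => (!₂[(1 / TowerRates.wide.N j) * Real.cos (2 * π * s),
          (1 / TowerRates.wide.N j) * Real.sin (2 * π * s), 0] : EuclideanSpace ℝ (Fin 3))) :=
  ⟨speedFloor TowerRates.wide j, strainFloor TowerRates.wide j, slabCeiling TowerRates.wide j,
    coreFloor TowerRates.wide j⟩

/-! ## §4 The base number: the low-strain layer's strain against `A₀` -/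

/-- **At the base the low-strain layer needs `(18/25)N₁² ∈ (0.41·A₀, 0.42·A₀)`** (wide rates: `N₁ ∈ (445, 446)`,
`A₀ ∈ (345901, 345902)`), against `(6/5)N₁² ≈ 0.69·A₀` for the card's layer. [folklore] -/
theorem strain_low_one_bounds :
    0.41 * TowerRates.wide.A 0 < 18 / 25 * TowerRates.wide.N 1 ^ 2 ∧
      18 / 25 * TowerRates.wide.N 1 ^ 2 < 0.42 * TowerRates.wide.A 0 := by
  obtain ⟨hN1, hN2⟩ := TowerRates.wide_N_one_bounds
  obtain ⟨hA1, hA2⟩ := TowerRates.wide_A_zero_bounds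
  constructor <;> nlinarith

/-- The card's layer strain at the base for comparison: `(6/5)N₁² ∈ (0.68·A₀, 0.70·A₀)`. [folklore] -/
theorem strain_card_one_bounds :
    0.68 * TowerRates.wide.A 0 < 6 / 5 * TowerRates.wide.N 1 ^ 2 ∧
      6 / 5 * TowerRates.wide.N 1 ^ 2 < 0.70 * TowerRates.wide.A 0 := by
  obtain ⟨hN1, hN2⟩ := TowerRates.wide_N_one_bounds
  obtain ⟨hA1, hA2⟩ := TowerRates.wide_A_zero_bounds
  constructor <;> nlinarith

end SheetReadoutLow

end Summit.NavierStokesRegularity.FluidComputer.PalasekTowerClayBridge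

end
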